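import Literature.NumberTheory.Sieve.SmoothParitySievedLemmas
import Literature.NumberTheory.Sieve.SmoothTernaryCrudeCountScales
import Literature.NumberTheory.Sieve.SmoothParityAsymptoticLemmas
import Literature.NumberTheory.Sieve.SmoothProfileMinor
import Literature.NumberTheory.Sieve.SmoothNumbersAPSegment
import HarnessLib

/-!
# The sieved lower bound for parity-class friable ternary counts: the large sieving primes

Topic `Literature/NumberTheory/Sieve`, namespace `Literature.NumberTheory.Sieve.SmoothArcs`; a PROVED file, the tail
estimate of `SmoothParitySieved` ([Harper2016, §5]).  In the polylog regime `y = ⌊(log x)^{100000}⌋` (`x → ∞` natural),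
with `α = α(x,y)`, `𝓜 = x^αζ(α,y)/√(2πφ₂(α,y))`, `Mv_i = e_i^{−α}𝓜`, for profiles with `|p_{c_i}| ≤ 1` and bounded scalings
`e_i ≤ E₀`, dilations `d₁d₂ ∣ 2^k` with `d₁/e₁ + d₂/e₂ + 1/e₃ ≤ 1`: for every `δ > 0` and all large `x`,

`Σ_{(log x)^{180} < p ≤ y, p prime} ‖W(x/(e₁p), x/(e₂p), x/(e₃p))‖ ≤ δ · Mv₁Mv₂Mv₃/(x/e₃)`

(`parityTernary_sieved_tail`).  Proof: `‖W‖ ≤ #{friable solutions in the boxes ⌊x/(e_ip)⌋}` (`norm_parityTernarySum_le_card`),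
Harper's crude Hölder count at shrunken boxes `ternary_crude_count_scales`
(`≤ C (log x)^{24} p^{−7/6} Ψ(x,y)³/x`), `Ψ(x,y) ≤ 3√(2π)𝓜` (`card_smoothNumbersUpTo_le_three_mul_saddleSize`),
`𝓜³/x ≤ E₀² Mv₁Mv₂Mv₃/(x/e₃)` and `Σ_{p > (log x)^{180}} p^{−7/6} ≤ 12 (log x)^{−30}`.

## References

* A. J. Harper, Compositio Math. 152 (2016), Theorem 2 and §5 [Harper2016].
* A. Hildebrand, G. Tenenbaum, Trans. AMS 296 (1986), Thm 1 [HildebrandTenenbaum1986].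
-/

noncomputable section

open Finset Real Complex Filter Topology

namespace Literature.NumberTheory.Sieve

namespace SmoothArcs

open Sieved

/-- `Σ_{P < n ≤ N} n^{−7/6} ≤ 12/L^{30}` when `L^{180} ≤ 2P` (`P ≥ 1`, `L > 0`): the integral comparison
`GPY.sum_Ioc_rpow_neg_le` and `P^{1/6} ≥ L^{30}/2`. [folklore] -/
theorem Sieved.sum_Ioc_rpow_seven_sixths_le {P N : ℕ} {L : ℝ} (hL : 0 < L) (hP : 1 ≤ P) (hPL : L ^ 180 ≤ 2 * P) :
    ∑ n ∈ Finset.Ioc P N, (n : ℝ) ^ (-(7 / 6 : ℝ)) ≤ 12 / L ^ 30 := by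
  have hP0 : (0 : ℝ) < P := by exact_mod_cast (show 0 < P by omega)
  refine (GPY.sum_Ioc_rpow_neg_le (M := N) hP (show (1 : ℝ) < 7 / 6 by norm_num)).trans ?_
  rw [show (1 : ℝ) - 7 / 6 = -((6 : ℕ) : ℝ)⁻¹ by norm_num, show (7 : ℝ) / 6 - 1 = 1 / 6 by norm_num,
    Real.rpow_neg hP0.le]
  -- `L^30/2 ≤ P^{1/6}`
  have h6 : (L ^ 30 / 2) ^ 6 ≤ P := by
    have : (L ^ 30 / 2) ^ 6 = L ^ 180 / 64 := by ring
    rw [this]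
    linarith [pow_nonneg hL.le 180]
  have hroot : L ^ 30 / 2 ≤ (P : ℝ) ^ ((6 : ℕ) : ℝ)⁻¹ := by
    calc L ^ 30 / 2 = ((L ^ 30 / 2) ^ 6) ^ ((6 : ℕ) : ℝ)⁻¹ :=
          (Real.pow_rpow_inv_natCast (by positivity) (by norm_num)).symm
      _ ≤ (P : ℝ) ^ ((6 : ℕ) : ℝ)⁻¹ := Real.rpow_le_rpow (by positivity) h6 (by positivity)
  have hL30 : 0 < L ^ 30 / 2 := by positivity
  calc ((P : ℝ) ^ ((6 : ℕ) : ℝ)⁻¹)⁻¹ / (1 / 6) = 6 * ((P : ℝ) ^ ((6 : ℕ) : ℝ)⁻¹)⁻¹ := by ring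
    _ ≤ 6 * (L ^ 30 / 2)⁻¹ := by
        refine mul_le_mul_of_nonneg_left ?_ (by norm_num)
        exact inv_anti₀ hL30 hroot
    _ = 12 / L ^ 30 := by field_simp; ring

set_option maxHeartbeats 4000000 in
/-- **THE LARGE SIEVING PRIMES.**  See the module docstring: for `|p_{c_i}| ≤ 1`, `e_i ≤ E₀`, `d₁d₂ ∣ 2^k`,
`d₁/e₁ + d₂/e₂ + 1/e₃ ≤ 1`, `δ > 0`, for all large natural `x`,
`Σ_{(log x)^{180} < p ≤ y prime} ‖W(x/(e_ip))‖ ≤ δ Mv₁Mv₂Mv₃/(x/e₃)`. [cite: Harper2016, Theorem 2 and §5] -/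
theorem parityTernary_sieved_tail (E₀ : ℕ) {c₁ c₂ c₃ : ℤ → ℂ}
    (hle₁ : ∀ v : ℝ, ‖profileFn c₁ v‖ ≤ 1) (hle₂ : ∀ v : ℝ, ‖profileFn c₂ v‖ ≤ 1) (hle₃ : ∀ v : ℝ, ‖profileFn c₃ v‖ ≤ 1)
    {δ : ℝ} (hδ : 0 < δ) :
    ∀ᶠ x : ℕ in atTop, ∀ (σ : ℤ) (e₁ e₂ e₃ d₁ d₂ k : ℕ),
      (σ = 1 ∨ σ = -1) → 1 ≤ e₁ → 1 ≤ e₂ → 1 ≤ e₃ → e₁ ≤ E₀ → e₂ ≤ E₀ → e₃ ≤ E₀ →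
      d₁ * d₂ ∣ 2 ^ k → (d₁ : ℝ) / e₁ + d₂ / e₂ + 1 / e₃ ≤ 1 →
      ∑ p ∈ ((Finset.range (⌊Real.log (x : ℝ) ^ 100000⌋₊ + 1)).filter (fun p => p.Prime ∧ 3 ≤ p)).filter (fun p : ℕ => ¬((p : ℝ) ≤ Real.log (x : ℝ) ^ 180)),
          ‖parityTernarySum ⌊Real.log (x : ℝ) ^ 100000⌋₊ σ d₁ d₂ ((x : ℝ) / e₁ / p) ((x : ℝ) / e₂ / p) ((x : ℝ) / e₃ / p) c₁ c₂ c₃‖ ≤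
        δ * (((e₁ : ℝ) ^ (-saddlePoint (x : ℝ) ⌊Real.log (x : ℝ) ^ 100000⌋₊) * ((x : ℝ) ^ saddlePoint (x : ℝ) ⌊Real.log (x : ℝ) ^ 100000⌋₊ * smoothZeta (saddlePoint (x : ℝ) ⌊Real.log (x : ℝ) ^ 100000⌋₊) ⌊Real.log (x : ℝ) ^ 100000⌋₊ / Real.sqrt (2 * Real.pi * saddlePhi₂ (saddlePoint (x : ℝ) ⌊Real.log (x : ℝ) ^ 100000⌋₊) ⌊Real.log (x : ℝ) ^ 100000⌋₊))) * ((e₂ : ℝ) ^ (-saddlePoint (x : ℝ) ⌊Real.log (x : ℝ) ^ 100000⌋₊) * ((x : ℝ) ^ saddlePoint (x : ℝ) ⌊Real.log (x : ℝ) ^ 100000⌋₊ * smoothZeta (saddlePoint (x : ℝ) ⌊Real.log (x : ℝ) ^ 100000⌋₊) ⌊Real.log (x : ℝ) ^ 100000⌋₊ / Real.sqrt (2 * Real.pi * saddlePhi₂ (saddlePoint (x : ℝ) ⌊Real.log (x : ℝ) ^ 100000⌋₊) ⌊Real.log (x : ℝ) ^ 100000⌋₊))) * ((e₃ : ℝ)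 ^ (-saddlePoint (x : ℝ) ⌊Real.log (x : ℝ) ^ 100000⌋₊) * ((x : ℝ) ^ saddlePoint (x : ℝ) ⌊Real.log (x : ℝ) ^ 100000⌋₊ * smoothZeta (saddlePoint (x : ℝ) ⌊Real.log (x : ℝ) ^ 100000⌋₊) ⌊Real.log (x : ℝ) ^ 100000⌋₊ / Real.sqrt (2 * Real.pi * saddlePhi₂ (saddlePoint (x : ℝ) ⌊Real.log (x : ℝ) ^ 100000⌋₊) ⌊Real.log (x : ℝ) ^ 100000⌋₊)))) / ((x : ℝ) / e₃) := by
  obtain ⟨C, hC, hcrude⟩ := ternary_crude_count_scales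
  obtain ⟨x₀, hΨ⟩ := card_smoothNumbersUpTo_le_three_mul_saddleSize
  obtain ⟨x₁, hlt1⟩ := saddlePoint_lt_one
  set K : ℝ := C * (12 * (27 * Real.sqrt (2 * Real.pi) ^ 3 * (E₀ : ℝ) ^ 2)) with hKdef
  have hK : 0 ≤ K := by positivity
  have EK : ∀ᶠ x : ℝ in atTop, K / δ ≤ Real.log x ^ 6 :=
    ((tendsto_pow_atTop (by norm_num)).comp Real.tendsto_log_atTop).eventually_ge_atTop _
  have EE : ∀ᶠ x : ℝ in atTop, (2 * E₀ : ℝ) ≤ Real.log x := Real.tendsto_log_atTop.eventually_ge_atTop _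
  have T : Tendsto (fun x : ℕ => (x : ℝ)) atTop atTop := tendsto_natCast_atTop_atTop
  filter_upwards [hcrude, T.eventually polylog_regime_basic, T.eventually (polylog_regime_real_scales (max x₀ x₁)),
    T.eventually EK, T.eventually EE] with x hcr hb hreg hKL hEL σ e₁ e₂ e₃ d₁ d₂ k hσ he₁ he₂ he₃ heE₁ heE₂ heE₃ hdk hde
  -- ### the regime
  obtain ⟨hx1, hL2, hy2, -, -, hy4, hy8, hlogy6, -, h200, hsqx⟩ := hb
  obtain ⟨hx01, -, -, -, hα4, -, -, -⟩ := hreg (x : ℝ) hsqx le_rfl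
  clear hreg
  simp only [max_le_iff] at hx01
  obtain ⟨hxx₀, hxx₁⟩ := hx01
  set Lx : ℝ := Real.log (x : ℝ) with hLx
  set y : ℕ := ⌊Lx ^ 100000⌋₊ with hy
  set α : ℝ := saddlePoint (x : ℝ) y with hαdef
  have hx0 : (0 : ℝ) < x := by linarith
  have hL1 : 1 ≤ Lx := by linarith
  have hL0 : 0 ≤ Lx := by linarith
  have hy1 : 1 ≤ y := by omega
  have hy1r : (1 : ℝ) ≤ y := by exact_mod_cast hy1
  have hysq : (y : ℝ) ≤ (x : ℝ) ^ (1 / 2 : ℝ) := (le_self_pow₀ hy1r (by norm_num)).trans h200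
  have hα1 : α < 1 := by
    refine hlt1 (x : ℝ) y hxx₁ ((pow_le_pow_right₀ hL1 (by norm_num)).trans hy4) (hysq.trans hsqx) ?_
    have : (0 : ℝ) ≤ Lx ^ (1 / 6 : ℝ) := Real.rpow_nonneg hL0 _
    linarith
  have hα0 : 0 < α := by linarith
  have hφ : 0 < saddlePhi₂ α y := lt_of_lt_of_le (by norm_num) (fifth_le_saddlePhi₂ hy2 hα0 (by linarith))
  have hζ := smoothZeta_pos (y := y) hα0
  -- ### `Ψ(x, y) ≤ 3 √(2π) 𝓜` and `Ψ³/x ≤ 27 (√(2π))³ E₀² Q`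
  have hΨ' := hΨ (x : ℝ) y hxx₀ hy8 hlogy6 (x : ℝ) le_rfl
  rw [Nat.floor_natCast, saddleSize_eq_sqrt_two_pi_mul hφ] at hΨ'
  set M₀ : ℝ := (x : ℝ) ^ α * smoothZeta α y / Real.sqrt (2 * Real.pi * saddlePhi₂ α y) with hM₀def
  have hM₀ : 0 < M₀ := by positivity
  rw [mul_div_assoc]
  set Q : ℝ := ((e₁ : ℝ) ^ (-α) * M₀) * ((e₂ : ℝ) ^ (-α) * M₀) * ((e₃ : ℝ) ^ (-α) * M₀) / ((x : ℝ) / e₃) with hQdef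
  have hQ0 : 0 ≤ Q := by positivity
  set Ψ : ℝ := ((Nat.smoothNumbersUpTo x (y + 1)).card : ℝ) with hΨdef
  have hΨ0 : 0 ≤ Ψ := Nat.cast_nonneg _
  have hΨ3 : Ψ ^ 3 / x ≤ 27 * Real.sqrt (2 * Real.pi) ^ 3 * (E₀ : ℝ) ^ 2 * Q := by
    have h1 : Ψ ^ 3 ≤ (3 * (Real.sqrt (2 * Real.pi) * M₀)) ^ 3 := pow_le_pow_left₀ hΨ0 hΨ' 3
    have h2 := master_cube_div_le hx0 hM₀.le hα1.le he₁ he₂ he₃ heE₁ heE₂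
    calc Ψ ^ 3 / x ≤ (3 * (Real.sqrt (2 * Real.pi) * M₀)) ^ 3 / x := div_le_div_of_nonneg_right h1 hx0.le
      _ = 27 * Real.sqrt (2 * Real.pi) ^ 3 * (M₀ ^ 3 / x) := by ring
      _ ≤ 27 * Real.sqrt (2 * Real.pi) ^ 3 * ((E₀ : ℝ) ^ 2 * Q) := mul_le_mul_of_nonneg_left h2 (by positivity)
      _ = 27 * Real.sqrt (2 * Real.pi) ^ 3 * (E₀ : ℝ) ^ 2 * Q := by ring
  -- ### scalings
  have he₁1 : (1 : ℝ) ≤ e₁ := by exact_mod_cast he₁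
  have heE₁r : (e₁ : ℝ) ≤ E₀ := by exact_mod_cast heE₁
  have hE1 : (1 : ℝ) ≤ E₀ := he₁1.trans heE₁r
  have hE0 : (0 : ℝ) < E₀ := by linarith
  have hEy : (2 * E₀ : ℝ) ≤ y := hEL.trans ((le_self_pow₀ hL1 (by norm_num)).trans hy4)
  -- ### the large sieving primes, one at a time
  set LG := ((Finset.range (y + 1)).filter (fun p => p.Prime ∧ 3 ≤ p)).filter (fun p : ℕ => ¬((p : ℝ) ≤ Lx ^ 180)) with hLGdef
  have hpt : ∀ p ∈ LG, ‖parityTernarySum y σ d₁ d₂ ((x : ℝ) / e₁ / p) ((x : ℝ) / e₂ / p) ((x : ℝ) / e₃ / p) c₁ c₂ c₃‖ ≤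
      C * Lx ^ 24 * (p : ℝ) ^ (-(7 / 6 : ℝ)) * (Ψ ^ 3 / x) := by
    intro p hp
    simp only [hLGdef, Finset.mem_filter, Finset.mem_range, not_le] at hp
    obtain ⟨⟨hpy, hpp, hp3⟩, -⟩ := hp
    have hp0 : (0 : ℝ) < p := by exact_mod_cast hpp.pos
    have hp3r : (3 : ℝ) ≤ p := by exact_mod_cast hp3
    have hpyr : (p : ℝ) ≤ y := by exact_mod_cast Nat.lt_succ_iff.mp hpy
    -- the boxes `z_i = ⌊x/(e_i p)⌋`
    have hz : ∀ {e : ℕ}, 1 ≤ e → e ≤ E₀ →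
        (x : ℝ) ^ (1 / 2 : ℝ) ≤ (⌊(x : ℝ) / e / p⌋₊ : ℝ) ∧ ⌊(x : ℝ) / e / p⌋₊ ≤ x ∧
          (⌊(x : ℝ) / e / p⌋₊ : ℝ) ≤ (x : ℝ) / e / p ∧
          ((⌊(x : ℝ) / e / p⌋₊ : ℝ) / x) ^ (7 / 12 : ℝ) ≤ (p : ℝ) ^ (-(7 / 12 : ℝ)) := by
      intro e he heE
      have he0 : (0 : ℝ) < e := by exact_mod_cast (show 0 < e by omega)
      have he1 : (1 : ℝ) ≤ e := by exact_mod_cast he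
      have heEr : (e : ℝ) ≤ E₀ := by exact_mod_cast heE
      have hfl_le : (⌊(x : ℝ) / e / p⌋₊ : ℝ) ≤ (x : ℝ) / e / p := Nat.floor_le (by positivity)
      have hfl_ge : (x : ℝ) / e / p - 1 ≤ ⌊(x : ℝ) / e / p⌋₊ := (Nat.sub_one_lt_floor _).le
      refine ⟨?_, Nat.floor_le_of_le ?_, hfl_le, ?_⟩
      · -- `√x ≤ x/(e p) − 1` since `e p ≤ E₀ y` and `2 E₀ y √x ≤ y² √x ≤ y^200 √x ≤ x`... via `2 E₀ y ≤ √x`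
        have hep : (e : ℝ) * p ≤ E₀ * y := mul_le_mul heEr hpyr hp0.le hE0.le
        have h2 : 2 * ((E₀ : ℝ) * y) ≤ (x : ℝ) ^ (1 / 2 : ℝ) := by
          calc 2 * ((E₀ : ℝ) * y) = (2 * E₀) * y := by ring
            _ ≤ (y : ℝ) * y := mul_le_mul_of_nonneg_right hEy (by positivity)
            _ = (y : ℝ) ^ 2 := by ring
            _ ≤ (y : ℝ) ^ 200 := pow_le_pow_right₀ hy1r (by norm_num)
            _ ≤ (x : ℝ) ^ (1 / 2 : ℝ) := h200
        have hsq1 : (1 : ℝ) ≤ (x : ℝ) ^ (1 / 2 : ℝ) := Real.one_le_rpow hx1.le (by norm_num)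
        have hxx : (x : ℝ) = (x : ℝ) ^ (1 / 2 : ℝ) * (x : ℝ) ^ (1 / 2 : ℝ) := by
          rw [← Real.rpow_add hx0]; norm_num
        have hkey : ((x : ℝ) ^ (1 / 2 : ℝ) + 1) * ((e : ℝ) * p) ≤ (x : ℝ) := by
          calc ((x : ℝ) ^ (1 / 2 : ℝ) + 1) * ((e : ℝ) * p) ≤ (2 * (x : ℝ) ^ (1 / 2 : ℝ)) * ((E₀ : ℝ) * y) :=
                mul_le_mul (by linarith) hep (by positivity) (by positivity)
            _ = (x : ℝ) ^ (1 / 2 : ℝ) * (2 * ((E₀ : ℝ) * y)) := by ring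
            _ ≤ (x : ℝ) ^ (1 / 2 : ℝ) * (x : ℝ) ^ (1 / 2 : ℝ) := mul_le_mul_of_nonneg_left h2 (by positivity)
            _ = (x : ℝ) := hxx.symm
        have h3 : (x : ℝ) ^ (1 / 2 : ℝ) + 1 ≤ (x : ℝ) / e / p := by
          rw [div_div, le_div_iff₀ (by positivity)]
          exact hkey
        linarith
      · exact (div_le_self (by positivity) (by linarith)).trans (div_le_self hx0.le he1)
      · have h1 : (⌊(x : ℝ) / e / p⌋₊ : ℝ) / x ≤ (p : ℝ)⁻¹ := by
          rw [div_le_iff₀ hx0]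
          calc (⌊(x : ℝ) / e / p⌋₊ : ℝ) ≤ (x : ℝ) / e / p := hfl_le
            _ ≤ (x : ℝ) / 1 / p := by gcongr
            _ = (p : ℝ)⁻¹ * x := by ring
        calc ((⌊(x : ℝ) / e / p⌋₊ : ℝ) / x) ^ (7 / 12 : ℝ) ≤ ((p : ℝ)⁻¹) ^ (7 / 12 : ℝ) :=
              Real.rpow_le_rpow (by positivity) h1 (by norm_num)
          _ = (p : ℝ) ^ (-(7 / 12 : ℝ)) := by rw [Real.inv_rpow hp0.le, Real.rpow_neg hp0.le]
    obtain ⟨hz₁lo, hz₁x, hz₁le, hz₁r⟩ := hz he₁ heE₁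
    obtain ⟨hz₂lo, hz₂x, hz₂le, hz₂r⟩ := hz he₂ heE₂
    obtain ⟨hz₃lo, hz₃x, hz₃le, -⟩ := hz he₃ heE₃
    -- `d₁z₁ + d₂z₂ + z₃ ≤ x`
    have hsumz : d₁ * ⌊(x : ℝ) / e₁ / p⌋₊ + d₂ * ⌊(x : ℝ) / e₂ / p⌋₊ + ⌊(x : ℝ) / e₃ / p⌋₊ ≤ x := by
      have he₁0 : (0 : ℝ) < e₁ := by exact_mod_cast (show 0 < e₁ by omega)
      have he₂0 : (0 : ℝ) < e₂ := by exact_mod_cast (show 0 < e₂ by omega)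
      have he₃0 : (0 : ℝ) < e₃ := by exact_mod_cast (show 0 < e₃ by omega)
      have h : (d₁ : ℝ) * ⌊(x : ℝ) / e₁ / p⌋₊ + d₂ * ⌊(x : ℝ) / e₂ / p⌋₊ + ⌊(x : ℝ) / e₃ / p⌋₊ ≤ x := by
        calc (d₁ : ℝ) * ⌊(x : ℝ) / e₁ / p⌋₊ + d₂ * ⌊(x : ℝ) / e₂ / p⌋₊ + ⌊(x : ℝ) / e₃ / p⌋₊
            ≤ d₁ * ((x : ℝ) / e₁ / p) + d₂ * ((x : ℝ) / e₂ / p) + (x : ℝ) / e₃ / p :=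
              add_le_add (add_le_add (mul_le_mul_of_nonneg_left hz₁le (Nat.cast_nonneg _))
                (mul_le_mul_of_nonneg_left hz₂le (Nat.cast_nonneg _))) hz₃le
          _ = ((d₁ : ℝ) / e₁ + d₂ / e₂ + 1 / e₃) * x / p := by
              field_simp
          _ ≤ 1 * x / p := by gcongr
          _ ≤ x := by rw [one_mul]; exact div_le_self hx0.le (by linarith)
      exact_mod_cast h
    have hdk' : d₁ * d₂ ∣ (2 * 3) ^ k := hdk.trans (pow_dvd_pow_of_dvd (dvd_mul_right 2 3) k)
    have hcnt := hcr 3 Nat.prime_three (by norm_num) _ _ _ d₁ d₂ k σ hσ hdk' hz₁lo hz₂lo hz₃lo hz₁x hz₂x hz₃x hsumz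
    have hW := norm_parityTernarySum_le_card y σ d₁ d₂ ((x : ℝ) / e₁ / p) ((x : ℝ) / e₂ / p) ((x : ℝ) / e₃ / p)
      hle₁ hle₂ hle₃
    refine hW.trans (hcnt.trans ?_)
    have hr12 : (((⌊(x : ℝ) / e₁ / p⌋₊ : ℕ) : ℝ) / x) ^ (7 / 12 : ℝ) * (((⌊(x : ℝ) / e₂ / p⌋₊ : ℕ) : ℝ) / x) ^ (7 / 12 : ℝ) ≤
        (p : ℝ) ^ (-(7 / 6 : ℝ)) := by
      calc _ ≤ (p : ℝ) ^ (-(7 / 12 : ℝ)) * (p : ℝ) ^ (-(7 / 12 : ℝ)) :=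
            mul_le_mul hz₁r hz₂r (Real.rpow_nonneg (by positivity) _) (Real.rpow_nonneg hp0.le _)
        _ = (p : ℝ) ^ (-(7 / 6 : ℝ)) := by rw [← Real.rpow_add hp0]; norm_num
    have hCL : 0 ≤ C * Lx ^ 24 := by positivity
    calc C * Lx ^ 24 * (((⌊(x : ℝ) / e₁ / p⌋₊ : ℕ) : ℝ) / x) ^ (7 / 12 : ℝ) *
          (((⌊(x : ℝ) / e₂ / p⌋₊ : ℕ) : ℝ) / x) ^ (7 / 12 : ℝ) * Ψ ^ 3 / x
        = C * Lx ^ 24 * ((((⌊(x : ℝ) / e₁ / p⌋₊ : ℕ) : ℝ) / x) ^ (7 / 12 : ℝ) *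
          (((⌊(x : ℝ) / e₂ / p⌋₊ : ℕ) : ℝ) / x) ^ (7 / 12 : ℝ)) * (Ψ ^ 3 / x) := by ring
      _ ≤ C * Lx ^ 24 * (p : ℝ) ^ (-(7 / 6 : ℝ)) * (Ψ ^ 3 / x) :=
          mul_le_mul_of_nonneg_right (mul_le_mul_of_nonneg_left hr12 hCL) (by positivity)
  -- ### summing `p^{−7/6}` over the large primes
  have hsumP : ∑ p ∈ LG, (p : ℝ) ^ (-(7 / 6 : ℝ)) ≤ 12 / Lx ^ 30 := by
    have hfl : (⌊Lx ^ 180⌋₊ : ℝ) ≤ Lx ^ 180 := Nat.floor_le (by positivity)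
    have hfl' : Lx ^ 180 ≤ (⌊Lx ^ 180⌋₊ : ℝ) + 1 := (Nat.lt_floor_add_one _).le
    have h180 : (2 : ℝ) ≤ Lx ^ 180 := hL2.trans (le_self_pow₀ hL1 (by norm_num))
    have hsub : LG ⊆ Finset.Ioc ⌊Lx ^ 180⌋₊ y := by
      intro p hp
      simp only [hLGdef, Finset.mem_filter, Finset.mem_range, not_le] at hp
      refine Finset.mem_Ioc.2 ⟨?_, Nat.lt_succ_iff.mp hp.1.1⟩
      exact_mod_cast hfl.trans_lt hp.2
    have hP1 : 1 ≤ ⌊Lx ^ 180⌋₊ := Nat.le_floor (by exact_mod_cast (show (1 : ℝ) ≤ Lx ^ 180 by linarith))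
    calc ∑ p ∈ LG, (p : ℝ) ^ (-(7 / 6 : ℝ)) ≤ ∑ n ∈ Finset.Ioc ⌊Lx ^ 180⌋₊ y, (n : ℝ) ^ (-(7 / 6 : ℝ)) :=
          Finset.sum_le_sum_of_subset_of_nonneg hsub fun _ _ _ => by positivity
      _ ≤ 12 / Lx ^ 30 := sum_Ioc_rpow_seven_sixths_le (by linarith) hP1 (by linarith)
  -- ### total
  have hL6 : K ≤ δ * Lx ^ 6 := by rw [div_le_iff₀' hδ] at hKL; exact hKL
  calc ∑ p ∈ LG, ‖parityTernarySum y σ d₁ d₂ ((x : ℝ) / e₁ / p) ((x : ℝ) / e₂ / p) ((x : ℝ) / e₃ / p) c₁ c₂ c₃‖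
      ≤ ∑ p ∈ LG, C * Lx ^ 24 * (p : ℝ) ^ (-(7 / 6 : ℝ)) * (Ψ ^ 3 / x) := Finset.sum_le_sum hpt
    _ = C * Lx ^ 24 * (Ψ ^ 3 / x) * ∑ p ∈ LG, (p : ℝ) ^ (-(7 / 6 : ℝ)) := by
        rw [Finset.mul_sum]
        exact Finset.sum_congr rfl fun p _ => by ring
    _ ≤ C * Lx ^ 24 * (27 * Real.sqrt (2 * Real.pi) ^ 3 * (E₀ : ℝ) ^ 2 * Q) * (12 / Lx ^ 30) :=
        mul_le_mul (mul_le_mul_of_nonneg_left hΨ3 (by positivity)) hsumP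
          (Finset.sum_nonneg fun _ _ => by positivity) (by positivity)
    _ = K * Q * (Lx ^ 24 / (Lx ^ 24 * Lx ^ 6)) := by rw [hKdef, ← pow_add]; ring
    _ = K * Q / Lx ^ 6 := by
        have h24 : Lx ^ 24 ≠ 0 := by positivity
        field_simp
    _ ≤ δ * Lx ^ 6 * Q / Lx ^ 6 := by gcongr
    _ = δ * Q := by
        have h6 : Lx ^ 6 ≠ 0 := by positivity
        field_simp

end SmoothArcs

end Literature.NumberTheory.Sieve

end
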